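import Summits.Ventures.Crystal3D.Theorems.StickyWulffConstantCoaxialWallLawCslCredits
import HarnessLib

/-!
# The grain lemma of the terrace/riser ledger for a CSL twin pair (coincidence sites allowed)

HONEST FRAMING. Part of the venture `Summits/Ventures/Crystal3D` (cell `crystal3d-full`), helper
`--supports` the crux `CoaxialWallLaw` (stmt-Ventures-19481, `route-Ventures-StickyWulffConstant`),
REGISTERED line `WallLedgerF` (planner cf-p1 gen 16), stub `stub_coaxialTwoSlabAdhesion`
(terrace/riser slot ledger, RIGID rung, CSL case).  Rung credit only.

Setting: CSL twin pair in normal form `Λ = M·Λ₀ + c` (the grain), `Λ' = M·Λ₀⁻ + c` (the other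
grain), `X ⊆ Λ ∪ Λ'` a RIGID `1`-separated filling of the cylinder `{−2R₀ ≤ x₂ ≤ h + 2R₀, disc ρ}`,
`P = Λ ∩ {[−2R₀, −R₀] × disc ρ} ⊆ X` the complete clamped slab, `3 ≤ R₀ ≤ ρ`.

Per-ball ledger (`csl_ball_ledger_nonCoinc`, `csl_ball_ledger_coinc`):
* at a NON-coincidence grain ball every contact sits at one of its own slots
  (`mem_movedFcc_of_dist_eq_one_of_rigid`), so `12 − deg = #vacant slots ≥ #outer credits +
  #climbing in-plane vacancies` — absorption at WEIGHT ONE, no rim condition;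
* a coincidence ball of the sample carries only outer credits, absorbed by sealing
  (`two_R₀_add_one_le_of_foreign`, `add_slot_mem_sample_of_high`) off the rim.

**Theorem (`csl_grain_ledger`).**  With `φ = (√2/4) Σ_w |⟪M w, e₃⟫|`, `s = √(1 − ⟪M e₃, e₃⟫²)`:

  `(2φ + (√6/2)·s) πρ² − 135√2 πρ − 72(R₀+2)(ρ−1) ≤ Σ_{x ∈ X ∩ Λ, x ∉ Λ' ∨ x ∈ P} (12 − deg x) + 24·#{rim balls of P}`

(outer face `outerCredits_ge` + the non-coincidence riser count `csl_upInPlane_credits_ge`, factor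
`½` from `csl_card_tops_le_two_mul_nonCoinc`).

WHAT THIS IS NOT: the top grain (mirror) and the two-grain assembly (next file), the stub; rung
F-C1 not moved.
-/

noncomputable section

namespace Summit.Ventures.Crystal3D.Theorems

open Summit.Ventures.Crystal3D Finset
open Literature.MathematicalPhysics.StatisticalMechanics (fccStacking barlowStacking)
open scoped InnerProductSpace

open scoped Classical in
/-- **Per-ball ledger at a non-coincidence ball of a rigid CSL twin filling** (weight one). -/
theorem csl_ball_ledger_nonCoinc
    (M : EuclideanSpace ℝ (Fin 3) ≃ₗᵢ[ℝ] EuclideanSpace ℝ (Fin 3)) (c : EuclideanSpace ℝ (Fin 3))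
    (X P : Finset (EuclideanSpace ℝ (Fin 3))) (R₀ h ρ : ℝ)
    (hcell : ∀ p ∈ X, -(2 * R₀) ≤ p 2 ∧ p 2 ≤ h + 2 * R₀ ∧ p 0 ^ 2 + p 1 ^ 2 ≤ ρ ^ 2)
    (hP : ∀ p, p ∈ P ↔ (p ∈ (fun q => M q + c) '' fccStacking 1 (Real.sqrt (2 / 3)) ∧
      -(2 * R₀) ≤ p 2 ∧ p 2 ≤ -R₀ ∧ p 0 ^ 2 + p 1 ^ 2 ≤ ρ ^ 2))
    (hrigid : ∀ p ∈ X, p ∈ (fun q => M q + c) '' fccStacking 1 (Real.sqrt (2 / 3)) ∨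
      p ∈ (fun q => M q + c) '' barlowStacking 1 (Real.sqrt (2 / 3)) (fun _ : ℤ => (-1 : ℤ)))
    {x : EuclideanSpace ℝ (Fin 3)}
    (hxΛ : x ∈ (fun q => M q + c) '' fccStacking 1 (Real.sqrt (2 / 3)))
    (hxΛ' : x ∉ (fun q => M q + c) '' barlowStacking 1 (Real.sqrt (2 / 3)) (fun _ : ℤ => (-1 : ℤ))) :
    ((fccSlots.filter fun w => ⟪M w, EuclideanSpace.single (2 : Fin 3) (1 : ℝ)⟫_ℝ < 0).filter
        fun w => x ∈ P.filter (fun p => p + M w ∉ P)).card +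
      (fccSlots.filter fun w => w 2 = 0 ∧ (x + M w ∉ X ∧ x 2 < (x + M w) 2)).card ≤
      12 - (X.filter fun q => dist x q = 1).card := by
  classical
  set e₃ : EuclideanSpace ℝ (Fin 3) := EuclideanSpace.single (2 : Fin 3) (1 : ℝ) with he₃
  set Λ : Set (EuclideanSpace ℝ (Fin 3)) := (fun q => M q + c) '' fccStacking 1 (Real.sqrt (2 / 3)) with hΛ
  set Oc : Finset (EuclideanSpace ℝ (Fin 3)) := (fccSlots.filter fun w => ⟪M w, e₃⟫_ℝ < 0).filter
    fun w => x ∈ P.filter (fun p => p + M w ∉ P) with hOc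
  set U : Finset (EuclideanSpace ℝ (Fin 3)) :=
    fccSlots.filter fun w => w 2 = 0 ∧ (x + M w ∉ X ∧ x 2 < (x + M w) 2) with hU
  -- no foreign contacts
  have hc0 : (X.filter fun q => dist x q = 1 ∧ q ∉ Λ).card = 0 := by
    rw [Finset.card_eq_zero, Finset.eq_empty_iff_forall_notMem]
    intro q hq
    rw [mem_filter] at hq
    exact hq.2.2 (mem_movedFcc_of_dist_eq_one_of_rigid M c X hrigid hxΛ hxΛ' hq.1 hq.2.1)
  have hled := twelve_sub_degree_eq M c x X hxΛ
  rw [hc0] at hled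
  have hOcsub : Oc ⊆ fccSlots.filter fun w => x + M w ∉ X := by
    intro w hw
    rw [hOc, mem_filter, mem_filter] at hw
    obtain ⟨⟨hws, hα⟩, hxO⟩ := hw
    rw [mem_filter] at hxO
    rw [mem_filter]
    exact ⟨hws, outerSlot_not_mem M c X P R₀ h ρ hcell hP (mem_fcc_of_mem_fccSlots hws) hα.le
      hxO.1 hxO.2⟩
  have hUsub : U ⊆ fccSlots.filter fun w => x + M w ∉ X := by
    intro w hw
    rw [hU, mem_filter] at hw
    rw [mem_filter]
    exact ⟨hw.1, hw.2.2.1⟩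
  have hdj : Disjoint Oc U := by
    rw [Finset.disjoint_left]
    intro w hwO hwU
    rw [hOc, mem_filter, mem_filter] at hwO
    rw [hU, mem_filter] at hwU
    have h1 : ⟪M w, e₃⟫_ℝ < 0 := hwO.1.2
    have h2 : x 2 < (x + M w) 2 := hwU.2.2.2
    rw [apply_two_add_eq_inner] at h2
    linarith
  have hle : Oc.card + U.card ≤ (fccSlots.filter fun w => x + M w ∉ X).card := by
    rw [← card_union_of_disjoint hdj]
    exact card_le_card (union_subset hOcsub hUsub)
  have h12 : (fccSlots.filter fun w => x + M w ∉ X).card ≤ 12 :=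
    (card_filter_le _ _).trans (by rw [card_fccSlots])
  omega

open scoped Classical in
/-- **Per-ball ledger at a non-rim coincidence ball of the sample** (outer credits only). -/
theorem csl_ball_ledger_coinc
    (M : EuclideanSpace ℝ (Fin 3) ≃ₗᵢ[ℝ] EuclideanSpace ℝ (Fin 3)) (c : EuclideanSpace ℝ (Fin 3))
    (X P : Finset (EuclideanSpace ℝ (Fin 3))) (R₀ h ρ : ℝ) (hR₀ : 3 ≤ R₀) (hρ : R₀ ≤ ρ)
    (hX : ∀ p ∈ X, ∀ q ∈ X, p ≠ q → 1 ≤ dist p q)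
    (hcell : ∀ p ∈ X, -(2 * R₀) ≤ p 2 ∧ p 2 ≤ h + 2 * R₀ ∧ p 0 ^ 2 + p 1 ^ 2 ≤ ρ ^ 2)
    (hPX : P ⊆ X)
    (hP : ∀ p, p ∈ P ↔ (p ∈ (fun q => M q + c) '' fccStacking 1 (Real.sqrt (2 / 3)) ∧
      -(2 * R₀) ≤ p 2 ∧ p 2 ≤ -R₀ ∧ p 0 ^ 2 + p 1 ^ 2 ≤ ρ ^ 2))
    {x : EuclideanSpace ℝ (Fin 3)} (hxP : x ∈ P) (hxrim : x 0 ^ 2 + x 1 ^ 2 ≤ (ρ - 2) ^ 2) :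
    ((fccSlots.filter fun w => ⟪M w, EuclideanSpace.single (2 : Fin 3) (1 : ℝ)⟫_ℝ < 0).filter
        fun w => x ∈ P.filter (fun p => p + M w ∉ P)).card ≤
      12 - (X.filter fun q => dist x q = 1).card := by
  classical
  set e₃ : EuclideanSpace ℝ (Fin 3) := EuclideanSpace.single (2 : Fin 3) (1 : ℝ) with he₃
  set Λ : Set (EuclideanSpace ℝ (Fin 3)) := (fun q => M q + c) '' fccStacking 1 (Real.sqrt (2 / 3)) with hΛ
  set Oc : Finset (EuclideanSpace ℝ (Fin 3)) := (fccSlots.filter fun w => ⟪M w, e₃⟫_ℝ < 0).filter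
    fun w => x ∈ P.filter (fun p => p + M w ∉ P) with hOc
  have hxΛ : x ∈ Λ := ((hP x).1 hxP).1
  have hdeg12 : (X.filter fun q => dist x q = 1).card ≤ 12 := card_filter_dist_eq_one_le_twelve X hX x
  by_cases hfor : ∃ q ∈ X, q ∉ Λ ∧ dist x q = 1
  · -- a foreign contact: `x` is high, no outer credit
    obtain ⟨q, hqX, hqΛ, hxq⟩ := hfor
    have hhigh := two_R₀_add_one_le_of_foreign M c X P R₀ h ρ hR₀ hρ hX hcell hPX hP hxrim hqX hqΛ hxq
    have hOc0 : Oc = ∅ := by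
      rw [Finset.eq_empty_iff_forall_notMem]
      intro w hw
      rw [hOc, mem_filter, mem_filter] at hw
      obtain ⟨⟨hws, hα⟩, hxO⟩ := hw
      rw [mem_filter] at hxO
      exact hxO.2 (add_slot_mem_sample_of_high M c P R₀ ρ hR₀ hρ hP hxP hxrim hhigh hws hα.le)
    rw [hOc0, card_empty]
    omega
  · push Not at hfor
    have hc0 : (X.filter fun q => dist x q = 1 ∧ q ∉ Λ).card = 0 := by
      rw [Finset.card_eq_zero, Finset.eq_empty_iff_forall_notMem]
      intro q hq
      rw [mem_filter] at hq
      exact hfor q hq.1 hq.2.2 hq.2.1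
    have hled := twelve_sub_degree_eq M c x X hxΛ
    rw [hc0] at hled
    have hOcsub : Oc ⊆ fccSlots.filter fun w => x + M w ∉ X := by
      intro w hw
      rw [hOc, mem_filter, mem_filter] at hw
      obtain ⟨⟨hws, hα⟩, hxO⟩ := hw
      rw [mem_filter] at hxO
      rw [mem_filter]
      exact ⟨hws, outerSlot_not_mem M c X P R₀ h ρ hcell hP (mem_fcc_of_mem_fccSlots hws) hα.le
        hxO.1 hxO.2⟩
    have hle := card_le_card hOcsub
    have h12 : (fccSlots.filter fun w => x + M w ∉ X).card ≤ 12 :=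
      (card_filter_le _ _).trans (by rw [card_fccSlots])
    omega

open scoped Classical in
/-- **The CSL grain lemma of the terrace/riser ledger (bottom grain).**  See the module docstring. -/
theorem csl_grain_ledger
    (M : EuclideanSpace ℝ (Fin 3) ≃ₗᵢ[ℝ] EuclideanSpace ℝ (Fin 3)) (c : EuclideanSpace ℝ (Fin 3))
    (X P : Finset (EuclideanSpace ℝ (Fin 3))) (R₀ h ρ : ℝ) (hR₀ : 3 ≤ R₀) (hρ : R₀ ≤ ρ)
    (hX : ∀ p ∈ X, ∀ q ∈ X, p ≠ q → 1 ≤ dist p q)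
    (hcell : ∀ p ∈ X, -(2 * R₀) ≤ p 2 ∧ p 2 ≤ h + 2 * R₀ ∧ p 0 ^ 2 + p 1 ^ 2 ≤ ρ ^ 2)
    (hPX : P ⊆ X)
    (hP : ∀ p, p ∈ P ↔ (p ∈ (fun q => M q + c) '' fccStacking 1 (Real.sqrt (2 / 3)) ∧
      -(2 * R₀) ≤ p 2 ∧ p 2 ≤ -R₀ ∧ p 0 ^ 2 + p 1 ^ 2 ≤ ρ ^ 2))
    (hrigid : ∀ p ∈ X, p ∈ (fun q => M q + c) '' fccStacking 1 (Real.sqrt (2 / 3)) ∨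
      p ∈ (fun q => M q + c) '' barlowStacking 1 (Real.sqrt (2 / 3)) (fun _ : ℤ => (-1 : ℤ))) :
    (2 * (Real.sqrt 2 / 4 * ∑ w ∈ fccSlots, |⟪M w, EuclideanSpace.single (2 : Fin 3) (1 : ℝ)⟫_ℝ|) +
        Real.sqrt 6 / 2 * Real.sqrt (1 - ⟪M (EuclideanSpace.single (2 : Fin 3) (1 : ℝ)),
          EuclideanSpace.single (2 : Fin 3) (1 : ℝ)⟫_ℝ ^ 2)) * Real.pi * ρ ^ 2 -
        135 * Real.sqrt 2 * Real.pi * ρ - 72 * (R₀ + 2) * (ρ - 1) ≤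
      ∑ x ∈ X.filter (fun x => x ∈ (fun q => M q + c) '' fccStacking 1 (Real.sqrt (2 / 3)) ∧
          (x ∉ (fun q => M q + c) '' barlowStacking 1 (Real.sqrt (2 / 3)) (fun _ : ℤ => (-1 : ℤ)) ∨
            x ∈ P)),
        ((12 : ℝ) - ((X.filter fun q => dist x q = 1).card : ℝ)) +
      24 * ((P.filter fun x => (ρ - 2) ^ 2 < x 0 ^ 2 + x 1 ^ 2).card : ℝ) := by
  classical
  set e₃ : EuclideanSpace ℝ (Fin 3) := EuclideanSpace.single (2 : Fin 3) (1 : ℝ) with he₃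
  set Λ : Set (EuclideanSpace ℝ (Fin 3)) := (fun q => M q + c) '' fccStacking 1 (Real.sqrt (2 / 3)) with hΛ
  set Λ' : Set (EuclideanSpace ℝ (Fin 3)) :=
    (fun q => M q + c) '' barlowStacking 1 (Real.sqrt (2 / 3)) (fun _ : ℤ => (-1 : ℤ)) with hΛ'
  set S : Finset (EuclideanSpace ℝ (Fin 3)) := X.filter (fun x => x ∈ Λ ∧ (x ∉ Λ' ∨ x ∈ P)) with hS
  set NC : Finset (EuclideanSpace ℝ (Fin 3)) := X.filter (fun x => x ∈ Λ ∧ x ∉ Λ') with hNC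
  set Down : Finset (EuclideanSpace ℝ (Fin 3)) := fccSlots.filter (fun w => ⟪M w, e₃⟫_ℝ < 0) with hDown
  set O : EuclideanSpace ℝ (Fin 3) → Finset (EuclideanSpace ℝ (Fin 3)) :=
    fun w => P.filter (fun p => p + M w ∉ P) with hO
  set U : EuclideanSpace ℝ (Fin 3) → ℕ :=
    fun x => (fccSlots.filter fun w => w 2 = 0 ∧ (x + M w ∉ X ∧ x 2 < (x + M w) 2)).card with hU
  set deg : EuclideanSpace ℝ (Fin 3) → ℕ := fun x => (X.filter fun q => dist x q = 1).card with hdeg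
  set k : EuclideanSpace ℝ (Fin 3) → ℕ :=
    fun x => (Down.filter fun w => x ∈ O w).card + (if x ∉ Λ' then U x else 0) with hk
  have hρ0 : (0 : ℝ) ≤ ρ := by linarith
  have hPS : P ⊆ S := by
    intro p hp
    rw [hS, mem_filter]
    exact ⟨hPX hp, ((hP p).1 hp).1, Or.inr hp⟩
  have hNCS : NC ⊆ S := by
    intro x hx
    rw [hNC, mem_filter] at hx
    rw [hS, mem_filter]
    exact ⟨hx.1, hx.2.1, Or.inl hx.2.2⟩
  -- (1) credit counts
  have hOut := outerCredits_ge M c P R₀ ρ hR₀ hρ hP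
  have hIn := csl_upInPlane_credits_ge M c X P R₀ ρ hR₀ hρ hX hPX hP
  -- (2) sum of the credits over `S`
  have hk_sum : ∑ x ∈ S, (k x : ℝ) = ∑ w ∈ Down, ((O w).card : ℝ) + ∑ x ∈ NC, (U x : ℝ) := by
    have hN1 : ∑ x ∈ S, (Down.filter fun w => x ∈ O w).card = ∑ w ∈ Down, (O w).card := by
      rw [Finset.sum_congr rfl (fun x _ => Finset.card_filter (fun w => x ∈ O w) Down), Finset.sum_comm]
      refine sum_congr rfl fun w _ => ?_
      rw [← Finset.card_filter, filter_mem_eq_inter, inter_eq_right.2 ((filter_subset _ _).trans hPS)]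
    have hN2 : ∑ x ∈ S, (if x ∉ Λ' then U x else 0) = ∑ x ∈ NC, U x := by
      rw [← Finset.sum_filter]
      congr 1
      ext x
      rw [mem_filter, hS, mem_filter, hNC, mem_filter]
      constructor
      · rintro ⟨⟨hx, hxΛ, -⟩, hn⟩; exact ⟨hx, hxΛ, hn⟩
      · rintro ⟨hx, hxΛ, hn⟩; exact ⟨⟨hx, hxΛ, Or.inl hn⟩, hn⟩
    have hN : ∑ x ∈ S, k x = ∑ w ∈ Down, (O w).card + ∑ x ∈ NC, U x := by
      simp only [hk, sum_add_distrib, hN1, hN2]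
    have := congrArg (Nat.cast : ℕ → ℝ) hN
    push_cast at this
    exact this
  -- (3) per-ball facts
  have hdeg12 : ∀ x, deg x ≤ 12 := fun x => card_filter_dist_eq_one_le_twelve X hX x
  have hk24 : ∀ x, k x ≤ 24 := by
    intro x
    have h1 : (Down.filter fun w => x ∈ O w).card ≤ 12 :=
      (card_filter_le _ _).trans ((card_filter_le _ _).trans (by rw [card_fccSlots]))
    have h2 : U x ≤ 12 := (card_filter_le _ _).trans (by rw [card_fccSlots])
    simp only [hk]; split_ifs <;> omega
  have hk_le : ∀ x ∈ S, ¬ (x ∈ P ∧ (ρ - 2) ^ 2 < x 0 ^ 2 + x 1 ^ 2) → (k x : ℝ) ≤ 12 - (deg x : ℝ) := by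
    intro x hx hrim
    have hx' := hx
    rw [hS, mem_filter] at hx'
    obtain ⟨hxX, hxΛ, hor⟩ := hx'
    have key : k x ≤ 12 - deg x := by
      by_cases hn : x ∉ Λ'
      · simp only [hk, if_pos hn, hdeg, hDown, hO, hU]
        exact csl_ball_ledger_nonCoinc M c X P R₀ h ρ hcell hP hrigid hxΛ hn
      · have hxP : x ∈ P := hor.resolve_left hn
        have hxrim : x 0 ^ 2 + x 1 ^ 2 ≤ (ρ - 2) ^ 2 := by
          by_contra hlt; push Not at hlt; exact hrim ⟨hxP, hlt⟩
        simp only [hk, if_neg hn, add_zero, hdeg, hDown, hO]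
        exact csl_ball_ledger_coinc M c X P R₀ h ρ hR₀ hρ hX hcell hPX hP hxP hxrim
    have h1 : ((k x : ℕ) : ℝ) ≤ ((12 - deg x : ℕ) : ℝ) := by exact_mod_cast key
    have h2 : ((12 - deg x : ℕ) : ℝ) = 12 - (deg x : ℝ) := by
      have := hdeg12 x
      push_cast [Nat.cast_sub this]
      ring
    rw [h2] at h1
    exact h1
  -- (4) pointwise with the rim indicator
  have hpt : ∀ x ∈ S, (k x : ℝ) - 24 * (if x ∈ P ∧ (ρ - 2) ^ 2 < x 0 ^ 2 + x 1 ^ 2 then 1 else 0) ≤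
      12 - (deg x : ℝ) := by
    intro x hx
    split_ifs with hr
    · have h1 : (k x : ℝ) ≤ 24 := by exact_mod_cast hk24 x
      have h2 : (deg x : ℝ) ≤ 12 := by exact_mod_cast hdeg12 x
      linarith
    · have := hk_le x hx hr; simpa using this
  have hsum := Finset.sum_le_sum hpt
  rw [sum_sub_distrib, ← mul_sum, sum_boole] at hsum
  have hrimS : (((S.filter fun x => x ∈ P ∧ (ρ - 2) ^ 2 < x 0 ^ 2 + x 1 ^ 2).card : ℕ) : ℝ) ≤
      ((P.filter fun x => (ρ - 2) ^ 2 < x 0 ^ 2 + x 1 ^ 2).card : ℝ) := by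
    have : (S.filter fun x => x ∈ P ∧ (ρ - 2) ^ 2 < x 0 ^ 2 + x 1 ^ 2) ⊆
        P.filter fun x => (ρ - 2) ^ 2 < x 0 ^ 2 + x 1 ^ 2 := by
      intro x hx
      rw [mem_filter] at hx ⊢
      exact ⟨hx.2.1, hx.2.2⟩
    exact_mod_cast card_le_card this
  rw [hk_sum] at hsum
  have hDeg : ∑ x ∈ S, ((12 : ℝ) - ((X.filter fun q => dist x q = 1).card : ℝ)) =
      ∑ x ∈ S, ((12 : ℝ) - (deg x : ℝ)) := rfl
  rw [hDeg]
  have hIn' : 1 / 2 * (Real.sqrt 6 * Real.sqrt (1 - ⟪M e₃, e₃⟫_ℝ ^ 2) * Real.pi * ρ ^ 2 -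
      30 * Real.sqrt 2 * Real.pi * ρ) - 72 * (R₀ + 2) * (ρ - 1) ≤ ∑ x ∈ NC, (U x : ℝ) := hIn
  linarith [hOut, hIn', hsum, hrimS]

end Summit.Ventures.Crystal3D.Theorems

end
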